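import Literature.Geometry.Manifold.FreeCircleAction
import Literature.Geometry.Manifold.InverseFunctionTheorem
import HarnessLib

/-!
# The equivariant flow box of a free circle action; no returns away from the identity

Second file of the package on free smooth circle actions (`FreeCircleAction.lean`: the
fundamental vector field does not vanish), written for the null fibration `Z → B = Z/S¹` of an
origami form (Cannas da Silva–Guillemin–Pires, *Symplectic Origami*, Def. 2.2; fact seat of
`Literature.Geometry.Symplectic.exists_symplecticCutPieces_of_isOrigamiForm`) and more generally as
the `G = S¹` input of the quotient manifold theorem (Lee, *Introduction to Smooth Manifolds*,
2nd ed., Thm. 21.10 — read in the held copy, pp. 573–575: slice charts, Prop. 21.7, and the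
Hausdorff property of `M/G`). Two ingredients of the slice charts are proved here:

* `exists_chart_circleAct_eq_add_smul` — **equivariant flow box**: about every point `n` of a
  manifold `N` (modelled on `ℝᵏ`) carrying a free smooth circle action `θ` there is a chart `ψ`
  of the maximal `C^∞` atlas, a vector `v ≠ 0`, a neighbourhood `T` of `n` and `ε > 0` with
  `ψ (θ (exp s) y) = ψ y + s • v` for `y ∈ T`, `|s| < ε`. Unlike the flow box of a vector field
  (`FlowBox.lean`, via the local flow of an ODE) this is obtained from the ACTION directly: for the
  chart `φ` at `n`, `c = φ n`, the velocity `v ≠ 0` of `t ↦ φ (θ (exp t) n)`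
  (`hasDerivAt_chart_circleOrbit_ne_zero`), a functional `ℓ` with `ℓ v = 1` and `P = id - ℓ • v`,
  the map `Λ z = φ (θ (exp ℓ(z - c)) (φ⁻¹ (c + P (z - c))))` is smooth near `c` with `DΛ(c) = id`,
  hence a local diffeomorphism (inverse function theorem, with
  `Literature.Geometry.Manifold.contDiffOn_symm_of_forall_hasFDerivAt_equiv` for the smoothness
  of the inverse on the whole target), and satisfies the equivariance
  `Λ (z + s v) = φ (θ (exp s) (φ⁻¹ (Λ z)))` identically (`exp (τ + s) = exp s · exp τ`); the chart
  is `ψ = Λ⁻¹ ∘ φ`.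
* `exists_nhds_forall_circleAct_mem_imp` (and `…_imp_abs_lt`) — **no returns away from `1`**:
  for a continuous free circle action on a Hausdorff space and a neighbourhood `U₁` of `1 ∈ S¹`,
  every point has a neighbourhood `W` such that `y, θ a y ∈ W ⇒ a ∈ U₁` (the pairs `(y, θ a y)`,
  `a ∉ U₁`, form a closed set, being a projection along the compact `S¹ ∖ U₁`, which misses
  `(n, n)` by freeness); with `U₁ = exp (-ε, ε)` (`centeredArc_mem_nhds_one`): `a = exp t`,
  `|t| < ε`.

Together they give slices meeting each nearby orbit exactly once (the next file constructs the
orbit space `N/S¹` as a manifold from them). Everything here is proved; no definitions, no facts.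

## References

* J. M. Lee, *Introduction to Smooth Manifolds*, 2nd ed., Springer GTM 218 (2012), Prop. 21.7,
  Thm. 21.10. [LeeSmoothManifolds2013]
* A. Cannas da Silva, V. Guillemin, A. R. Pires, *Symplectic Origami*, IMRN 2011 =
  arXiv:0909.4065, Def. 2.2 (the null fibration). [CannasdasilvaGuilleminPires2010]
-/

noncomputable section

open Set Metric Filter Function
open scoped Manifold ContDiff Topology

namespace Literature.Geometry.Manifold

section MaximalAtlas

variable {E : Type*} [NormedAddCommGroup E] [NormedSpace ℝ E]
  {M : Type*} [TopologicalSpace M] [ChartedSpace E M] [IsManifold 𝓘(ℝ, E) ∞ M]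

/-- A chart of the maximal `C^∞` atlas followed by a partial homeomorphism of the model space which
is smooth with smooth inverse is again in the maximal atlas (a copy of
`Literature.Topology.FourManifolds.trans_mem_maximalAtlas_of_contDiffOn`, to keep the imports of
this general file light). [folklore] -/
private theorem trans_mem_maximalAtlas_of_contDiffOn' {e : OpenPartialHomeomorph M E}
    (he : e ∈ IsManifold.maximalAtlas 𝓘(ℝ, E) ∞ M) (D : OpenPartialHomeomorph E E)
    (hD : ContDiffOn ℝ ∞ D D.source) (hD' : ContDiffOn ℝ ∞ D.symm D.target) :
    e ≫ₕ D ∈ IsManifold.maximalAtlas 𝓘(ℝ, E) ∞ M := by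
  rw [IsManifold.mem_maximalAtlas_iff_contMDiffOn, OpenPartialHomeomorph.coe_trans,
    OpenPartialHomeomorph.coe_trans_symm, OpenPartialHomeomorph.trans_source,
    OpenPartialHomeomorph.trans_target]
  constructor
  · exact (contMDiffOn_iff_contDiffOn.2 hD).comp
      ((contMDiffOn_of_mem_maximalAtlas he).mono inter_subset_left) fun x hx => hx.2
  · exact (contMDiffOn_symm_of_mem_maximalAtlas he).comp
      ((contMDiffOn_iff_contDiffOn.2 hD').mono inter_subset_left) fun x hx => hx.2

end MaximalAtlas

variable {k : ℕ} {N : Type*} [TopologicalSpace N] [ChartedSpace (EuclideanSpace ℝ (Fin k)) N]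
  [IsManifold (𝓡 k) ∞ N] {θ : Circle → N → N}

/-- **The orbit read in a chart has non-zero velocity**: for a free smooth circle action, the curve
`t ↦ φ (θ (exp t) n)` (`φ` the extended chart at `n`) has a derivative `v ≠ 0` at `t = 0` — the chart
differential is injective and the fundamental vector field of a free action does not vanish
(`mfderiv_circleOrbit_apply_one_ne_zero`). [cite: LeeSmoothManifolds2013, Prop. 21.7] -/
theorem hasDerivAt_chart_circleOrbit_ne_zero
    (hθ : ContMDiff ((𝓡 1).prod (𝓡 k)) (𝓡 k) ∞ (fun p : Circle × N => θ p.1 p.2))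
    (h1 : ∀ n, θ 1 n = n) (hmul : ∀ a b n, θ (a * b) n = θ a (θ b n))
    (hfree : ∀ a n, θ a n = n → a = 1) (n : N) :
    ∃ v : EuclideanSpace ℝ (Fin k), v ≠ 0 ∧
      HasDerivAt (fun t : ℝ => extChartAt (𝓡 k) n (θ (Circle.exp t) n)) v 0 := by
  set γ : ℝ → N := fun t => θ (Circle.exp t) n with hγ
  have hγ0 : γ 0 = n := by simp [hγ, h1]
  have hγs : ContMDiff 𝓘(ℝ, ℝ) (𝓡 k) ∞ γ := contMDiff_circleOrbit hθ n
  have hnφ : n ∈ (chartAt (EuclideanSpace ℝ (Fin k)) n).source := mem_chart_source _ n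
  have hφn : ContMDiffAt (𝓡 k) 𝓘(ℝ, EuclideanSpace ℝ (Fin k)) ∞ (extChartAt (𝓡 k) n) n :=
    contMDiffAt_extChartAt
  have hφγ : ContMDiffAt 𝓘(ℝ, ℝ) 𝓘(ℝ, EuclideanSpace ℝ (Fin k)) ∞ (extChartAt (𝓡 k) n ∘ γ) 0 :=
    hφn.comp_of_eq (hγs 0) hγ0
  have hdiff : DifferentiableAt ℝ (extChartAt (𝓡 k) n ∘ γ) 0 :=
    (contMDiffAt_iff_contDiffAt.1 hφγ).differentiableAt (by simp)
  refine ⟨deriv (extChartAt (𝓡 k) n ∘ γ) 0, ?_, hdiff.hasDerivAt⟩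
  -- `deriv (φ ∘ γ) 0 = dφ_n (γ' 0)` with `dφ_n` injective and `γ' 0 ≠ 0`
  have hγd : HasMFDerivAt 𝓘(ℝ, ℝ) (𝓡 k) γ 0 (mfderiv 𝓘(ℝ, ℝ) (𝓡 k) γ 0) :=
    (hγs.mdifferentiableAt (by decide)).hasMFDerivAt
  have hφd : HasMFDerivAt (𝓡 k) 𝓘(ℝ, EuclideanSpace ℝ (Fin k)) (extChartAt (𝓡 k) n) (γ 0)
      (mfderiv (𝓡 k) 𝓘(ℝ, EuclideanSpace ℝ (Fin k)) (extChartAt (𝓡 k) n) (γ 0)) :=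
    (mdifferentiableAt_extChartAt (hγ0 ▸ hnφ)).hasMFDerivAt
  have hcomp := (hφd.comp 0 hγd).mfderiv
  rw [hγ0] at hcomp
  have hinj : Injective (mfderiv (𝓡 k) 𝓘(ℝ, EuclideanSpace ℝ (Fin k)) (extChartAt (𝓡 k) n) n) :=
    (isInvertible_mfderiv_extChartAt (mem_extChartAt_source n)).injective
  have hne : mfderiv 𝓘(ℝ, ℝ) (𝓡 k) γ 0 (1 : ℝ) ≠ 0 :=
    mfderiv_circleOrbit_apply_one_ne_zero hθ h1 hmul hfree n
  intro h0
  apply hne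
  apply hinj
  have e1 : mfderiv 𝓘(ℝ, ℝ) 𝓘(ℝ, EuclideanSpace ℝ (Fin k)) (extChartAt (𝓡 k) n ∘ γ) 0 (1 : ℝ) =
      deriv (extChartAt (𝓡 k) n ∘ γ) 0 := by
    rw [mfderiv_eq_fderiv]
    rfl
  rw [hcomp] at e1
  exact (e1.trans h0).trans (map_zero _).symm

/-- **Equivariant flow box for a free circle action** (the `G = S¹` case of the slice charts in
the proof of the quotient manifold theorem, Lee 2012, Thm. 21.10; cf. Prop. 21.7): about every
point `n` there is a chart `ψ` of the maximal `C^∞` atlas, a vector `v ≠ 0`, an open set `T ∋ n`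
inside the chart domain and `ε > 0` such that for `y ∈ T` and `|s| < ε` the action of `exp s`
keeps `y` inside the chart domain and reads as the translation `ψ (θ (exp s) y) = ψ y + s • v`.
The chart is `ψ = Λ⁻¹ ∘ φ` for the chart `φ` at `n` and the local diffeomorphism
`Λ z = φ (θ (exp ℓ(z - c)) (φ⁻¹ (c + P (z - c))))` of the model space (`c = φ n`, `ℓ v = 1`,
`P = id - ℓ • v`), which has `DΛ(c) = id` (inverse function theorem) and satisfies
`Λ (z + s v) = φ (θ (exp s) (φ⁻¹ (Λ z)))` identically. [cite: LeeSmoothManifolds2013, Thm. 21.10] -/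
theorem exists_chart_circleAct_eq_add_smul
    (hθ : ContMDiff ((𝓡 1).prod (𝓡 k)) (𝓡 k) ∞ (fun p : Circle × N => θ p.1 p.2))
    (h1 : ∀ n, θ 1 n = n) (hmul : ∀ a b n, θ (a * b) n = θ a (θ b n))
    (hfree : ∀ a n, θ a n = n → a = 1) (n : N) :
    ∃ ψ ∈ IsManifold.maximalAtlas (𝓡 k) ∞ N, ∃ v : EuclideanSpace ℝ (Fin k), ∃ ε > (0 : ℝ),
      ∃ T : Set N, v ≠ 0 ∧ IsOpen T ∧ n ∈ T ∧ T ⊆ ψ.source ∧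
      ∀ y ∈ T, ∀ s ∈ Ioo (-ε) ε,
        θ (Circle.exp s) y ∈ ψ.source ∧ ψ (θ (Circle.exp s) y) = ψ y + s • v := by
  set φ := chartAt (EuclideanSpace ℝ (Fin k)) n with hφ
  have hφatlas : φ ∈ IsManifold.maximalAtlas (𝓡 k) ∞ N := IsManifold.chart_mem_maximalAtlas n
  have hnφ : n ∈ φ.source := mem_chart_source _ n
  set c : EuclideanSpace ℝ (Fin k) := φ n with hc
  have hcφ : c ∈ φ.target := φ.map_source hnφ
  have hφc : φ.symm c = n := φ.left_inv hnφ
  obtain ⟨v, hv0, hv'⟩ := hasDerivAt_chart_circleOrbit_ne_zero hθ h1 hmul hfree n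
  have hv : HasDerivAt (fun t : ℝ => φ (θ (Circle.exp t) n)) v 0 := hv'
  -- a functional with `ℓ v = 1` and the projection `P` onto its kernel along `v`
  set ℓ : EuclideanSpace ℝ (Fin k) →L[ℝ] ℝ := ((‖v‖ ^ 2)⁻¹ : ℝ) • innerSL ℝ v with hℓ
  have hℓv : ℓ v = 1 := by
    have h : ℓ v = (‖v‖ ^ 2)⁻¹ * innerSL ℝ v v := rfl
    rw [h, innerSL_apply_apply, real_inner_self_eq_norm_sq]
    exact inv_mul_cancel₀ (pow_ne_zero 2 (norm_ne_zero_iff.mpr hv0))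
  set P : EuclideanSpace ℝ (Fin k) →L[ℝ] EuclideanSpace ℝ (Fin k) :=
    ContinuousLinearMap.id ℝ _ - ℓ.smulRight v with hP
  have hP_apply : ∀ z, P z = z - ℓ z • v := fun z => by simp [hP]
  have hPv : P v = 0 := by rw [hP_apply, hℓv, one_smul, sub_self]
  have hℓP : ∀ z, ℓ (P z) = 0 := fun z => by
    rw [hP_apply, map_sub, map_smul, hℓv, smul_eq_mul, mul_one, sub_self]
  have hdecomp : ∀ z, P z + ℓ z • v = z := fun z => by rw [hP_apply, sub_add_cancel]
  -- the map `Λ`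
  set a : EuclideanSpace ℝ (Fin k) → EuclideanSpace ℝ (Fin k) := fun z => c + P (z - c) with ha
  set τ : EuclideanSpace ℝ (Fin k) → ℝ := fun z => ℓ (z - c) with hτ
  set G : EuclideanSpace ℝ (Fin k) → N := fun z => θ (Circle.exp (τ z)) (φ.symm (a z)) with hG
  set Λ : EuclideanSpace ℝ (Fin k) → EuclideanSpace ℝ (Fin k) := fun z => φ (G z) with hΛ
  have hac : a c = c := by simp [ha]
  have hτc : τ c = 0 := by simp [hτ]
  have hGc : G c = n := by
    simp only [hG, hτc, hac, Circle.exp_zero, h1, hφc]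
  have hΛc : Λ c = c := by
    show φ (G c) = c
    rw [hGc]
  -- its domain
  set D' : Set (EuclideanSpace ℝ (Fin k)) := a ⁻¹' φ.target with hD'
  have hac' : Continuous a := by
    simp only [ha]
    fun_prop
  have hτc' : Continuous τ := by
    simp only [hτ]
    fun_prop
  have hD'o : IsOpen D' := φ.open_target.preimage hac'
  have hGcont : ContinuousOn G D' := by
    have h1' : ContinuousOn (fun z => (Circle.exp (τ z), φ.symm (a z))) D' :=
      (Circle.exp.continuous.comp hτc').continuousOn.prodMk
        (φ.continuousOn_symm.comp hac'.continuousOn fun z hz => hz)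
    exact hθ.continuous.comp_continuousOn h1'
  set D : Set (EuclideanSpace ℝ (Fin k)) := D' ∩ G ⁻¹' φ.source with hD
  have hDo : IsOpen D := hGcont.isOpen_inter_preimage hD'o φ.open_source
  have hcD : c ∈ D := by
    refine ⟨?_, ?_⟩
    · show a c ∈ φ.target
      rwa [hac]
    · show G c ∈ φ.source
      rwa [hGc]
  -- smoothness of `Λ` on `D`
  have hGs : ContMDiffOn 𝓘(ℝ, EuclideanSpace ℝ (Fin k)) (𝓡 k) ∞ G D' := by
    have hin : ContMDiffOn 𝓘(ℝ, EuclideanSpace ℝ (Fin k)) ((𝓡 1).prod (𝓡 k)) ∞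
        (fun z => (Circle.exp (τ z), φ.symm (a z))) D' := by
      refine ContMDiffOn.prodMk ?_ ?_
      · have hτs : ContMDiff 𝓘(ℝ, EuclideanSpace ℝ (Fin k)) 𝓘(ℝ, ℝ) ∞ τ := by
          rw [contMDiff_iff_contDiff]
          simp only [hτ]
          fun_prop
        exact ((contMDiff_circleExp (m := ∞)).comp hτs).contMDiffOn
      · have has : ContMDiff 𝓘(ℝ, EuclideanSpace ℝ (Fin k)) 𝓘(ℝ, EuclideanSpace ℝ (Fin k)) ∞ a := by
          rw [contMDiff_iff_contDiff]
          simp only [ha]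
          fun_prop
        exact (contMDiffOn_chart_symm (I := 𝓡 k) (n := ∞) (x := n)).comp has.contMDiffOn
          fun z hz => hz
    exact hθ.comp_contMDiffOn hin
  have hΛD : ContDiffOn ℝ ∞ Λ D := by
    have h : ContMDiffOn 𝓘(ℝ, EuclideanSpace ℝ (Fin k)) 𝓘(ℝ, EuclideanSpace ℝ (Fin k)) ∞ Λ D :=
      (contMDiffOn_chart (I := 𝓡 k) (n := ∞) (x := n)).comp (hGs.mono inter_subset_left)
        fun z hz => hz.2
    exact contMDiffOn_iff_contDiffOn.1 h
  have hΛdiff : ∀ z ∈ D, HasFDerivAt Λ (fderiv ℝ Λ z) z := fun z hz =>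
    ((hΛD.differentiableOn (by simp) z hz).differentiableAt (hDo.mem_nhds hz)).hasFDerivAt
  -- **equivariance**: `Λ (z + s v) = φ (θ (exp s) (φ⁻¹ (Λ z)))` for `z ∈ D`
  have hequiv : ∀ z ∈ D, ∀ s : ℝ, Λ (z + s • v) = φ (θ (Circle.exp s) (φ.symm (Λ z))) := by
    intro z hz s
    have hτ' : τ (z + s • v) = τ z + s := by
      simp only [hτ]
      rw [add_sub_right_comm, map_add, map_smul, hℓv, smul_eq_mul, mul_one]
    have ha' : a (z + s • v) = a z := by
      simp only [ha]
      rw [add_sub_right_comm, map_add, map_smul, hPv, smul_zero, add_zero]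
    have hGz : φ.symm (Λ z) = G z := φ.left_inv hz.2
    simp only [hΛ]
    rw [hGz]
    simp only [hG, hτ', ha']
    rw [add_comm, Circle.exp_add, hmul]
  -- `DΛ(c) = id`
  have hL := hΛdiff c hcD
  have hΛ'c : fderiv ℝ Λ c = ContinuousLinearMap.id ℝ _ := by
    -- along `ker ℓ` the map `Λ` is the identity near `c`
    have hker : ∀ w, P w = w → fderiv ℝ Λ c w = w := by
      intro w hw
      have hℓw : ℓ w = 0 := by rw [← hw]; exact hℓP w
      have hγ : HasDerivAt (fun s : ℝ => c + s • w) w 0 := by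
        simpa using ((hasDerivAt_id (0 : ℝ)).smul_const w).const_add c
      have hd2 : HasDerivAt (Λ ∘ fun s : ℝ => c + s • w) (fderiv ℝ Λ c w) 0 :=
        HasFDerivAt.comp_hasDerivAt_of_eq (0 : ℝ) hL hγ (by simp)
      have hcont : Continuous fun s : ℝ => c + s • w := by fun_prop
      have hev : (Λ ∘ fun s : ℝ => c + s • w) =ᶠ[𝓝 0] fun s => c + s • w := by
        have hmem : {s : ℝ | c + s • w ∈ φ.target} ∈ 𝓝 (0 : ℝ) :=
          (φ.open_target.preimage hcont).mem_nhds (by simpa using hcφ)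
        filter_upwards [hmem] with s hs
        simp only [comp_apply, hΛ, hG, hτ, ha, add_sub_cancel_left, map_smul, hw, hℓw,
          smul_eq_mul, mul_zero, Circle.exp_zero, h1]
        exact φ.right_inv hs
      have hd1 : HasDerivAt (Λ ∘ fun s : ℝ => c + s • w) w 0 := hγ.congr_of_eventuallyEq hev
      exact hd2.unique hd1
    -- along `v` the map `Λ` is the orbit read in the chart
    have hcdir : fderiv ℝ Λ c v = v := by
      have hγ : HasDerivAt (fun s : ℝ => c + s • v) v 0 := by
        simpa using ((hasDerivAt_id (0 : ℝ)).smul_const v).const_add c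
      have hd2 : HasDerivAt (Λ ∘ fun s : ℝ => c + s • v) (fderiv ℝ Λ c v) 0 :=
        HasFDerivAt.comp_hasDerivAt_of_eq (0 : ℝ) hL hγ (by simp)
      have heq : (Λ ∘ fun s : ℝ => c + s • v) = fun s : ℝ => φ (θ (Circle.exp s) n) := by
        funext s
        have h := hequiv c hcD s
        rw [hΛc, hφc] at h
        exact h
      rw [heq] at hd2
      exact hd2.unique hv
    ext z : 1
    conv_lhs => rw [← hdecomp z]
    rw [map_add, map_smul, hker (P z) (by
      conv_lhs => rw [hP_apply (P z), hℓP, zero_smul, sub_zero]), hcdir,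
      ContinuousLinearMap.id_apply, hdecomp]
  -- the inverse function theorem at `c`
  have hn0 : (∞ : WithTop ℕ∞) ≠ 0 := by simp
  have hΛcn : ContDiffAt ℝ ∞ Λ c := hΛD.contDiffAt (hDo.mem_nhds hcD)
  have hΛderiv : HasFDerivAt Λ ((ContinuousLinearEquiv.refl ℝ (EuclideanSpace ℝ (Fin k)) :
      EuclideanSpace ℝ (Fin k) ≃L[ℝ] EuclideanSpace ℝ (Fin k)) :
        EuclideanSpace ℝ (Fin k) →L[ℝ] EuclideanSpace ℝ (Fin k)) c := by
    rw [ContinuousLinearEquiv.coe_refl, ← hΛ'c]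
    exact hL
  set W : Set (EuclideanSpace ℝ (Fin k)) := D ∩ (fderiv ℝ Λ) ⁻¹'
    range ((↑) : (EuclideanSpace ℝ (Fin k) ≃L[ℝ] EuclideanSpace ℝ (Fin k)) →
      EuclideanSpace ℝ (Fin k) →L[ℝ] EuclideanSpace ℝ (Fin k)) with hW
  have hWo : IsOpen W :=
    (hΛD.continuousOn_fderiv_of_isOpen hDo (by simp)).isOpen_inter_preimage hDo
      ContinuousLinearEquiv.isOpen
  have hcW : c ∈ W := ⟨hcD, ⟨ContinuousLinearEquiv.refl ℝ _, hΛderiv.fderiv.symm⟩⟩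
  set Ψ₀ := hΛcn.toOpenPartialHomeomorph Λ hΛderiv hn0 with hΨ₀
  set Ψ := Ψ₀.restrOpen W hWo with hΨ
  have hΨΛ : ∀ z, Ψ z = Λ z := fun z => rfl
  have hΨsrc : Ψ.source = Ψ₀.source ∩ W := Ψ₀.restrOpen_source W hWo
  have hcΨ : c ∈ Ψ.source := by
    rw [hΨsrc]
    exact ⟨hΛcn.mem_toOpenPartialHomeomorph_source hΛderiv hn0, hcW⟩
  have hΨW : Ψ.source ⊆ W := by rw [hΨsrc]; exact inter_subset_right
  have hΨD : Ψ.source ⊆ D := fun z hz => (hΨW hz).1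
  have hΨsm : ContDiffOn ℝ ∞ Ψ Ψ.source := by
    rw [show (Ψ : EuclideanSpace ℝ (Fin k) → EuclideanSpace ℝ (Fin k)) = Λ from funext hΨΛ]
    exact hΛD.mono hΨD
  have hΨsymm : ContDiffOn ℝ ∞ Ψ.symm Ψ.target := by
    refine contDiffOn_symm_of_forall_hasFDerivAt_equiv Ψ (fun z _ => hΨΛ z) hn0
      (fun b hb => hΛD.contDiffAt (hDo.mem_nhds (hΨD hb))) fun b hb => ?_
    obtain ⟨e, he⟩ := (hΨW hb).2
    exact ⟨e, he ▸ hΛdiff b (hΨD hb)⟩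
  -- the chart `ψ = Ψ⁻¹ ∘ φ`
  set ψ := φ ≫ₕ Ψ.symm with hψ
  have hψatlas : ψ ∈ IsManifold.maximalAtlas (𝓡 k) ∞ N :=
    trans_mem_maximalAtlas_of_contDiffOn' hφatlas Ψ.symm hΨsymm
      (by rw [OpenPartialHomeomorph.symm_symm, OpenPartialHomeomorph.symm_target]; exact hΨsm)
  have hψsrc : ψ.source = φ.source ∩ φ ⁻¹' Ψ.target := by
    rw [hψ, OpenPartialHomeomorph.trans_source, OpenPartialHomeomorph.symm_source]
  have hψ_apply : ∀ y, ψ y = Ψ.symm (φ y) := fun y => rfl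
  have hcΨt : c ∈ Ψ.target := by
    have h := Ψ.map_source hcΨ
    rwa [hΨΛ, hΛc] at h
  have hnψ : n ∈ ψ.source := by
    rw [hψsrc]
    exact ⟨hnφ, hcΨt⟩
  have hψn : ψ n = c := by
    rw [hψ_apply, ← hc]
    have h := Ψ.left_inv hcΨ
    rwa [hΨΛ, hΛc] at h
  -- a ball `ball c (2 r) ⊆ Ψ.source`, the tube `T = ψ⁻¹ (ball c r)` and `ε = r / ‖v‖`
  obtain ⟨r2, hr2, hball⟩ := Metric.isOpen_iff.1 Ψ.open_source c hcΨ
  set r := r2 / 2 with hr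
  have hr0 : 0 < r := by positivity
  set T : Set N := ψ.source ∩ ψ ⁻¹' ball c r with hT
  have hTo : IsOpen T := ψ.isOpen_inter_preimage isOpen_ball
  have hnT : n ∈ T := ⟨hnψ, by rw [mem_preimage, hψn]; exact mem_ball_self hr0⟩
  set ε := r / ‖v‖ with hε
  have hvn : 0 < ‖v‖ := norm_pos_iff.2 hv0
  have hε0 : 0 < ε := div_pos hr0 hvn
  refine ⟨ψ, hψatlas, v, ε, hε0, T, hv0, hTo, hnT, inter_subset_left, ?_⟩
  intro y hy s hs
  set z := ψ y with hz
  have hyψ : y ∈ ψ.source := hy.1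
  have hyφ : y ∈ φ.source := by rw [hψsrc] at hyψ; exact hyψ.1
  have hφyΨ : φ y ∈ Ψ.target := by rw [hψsrc] at hyψ; exact hyψ.2
  have hzsrc : z ∈ Ψ.source := Ψ.map_target hφyΨ
  have hΛz : Λ z = φ y := by rw [← hΨΛ, hz, hψ_apply, Ψ.right_inv hφyΨ]
  -- `z + s v ∈ Ψ.source`
  have hzs : z + s • v ∈ Ψ.source := by
    apply hball
    rw [mem_ball]
    have h1' : dist z c < r := hy.2
    have h2' : ‖s • v‖ < r := by
      rw [norm_smul, Real.norm_eq_abs]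
      exact (lt_div_iff₀ hvn).1 (abs_lt.2 hs)
    calc dist (z + s • v) c ≤ dist (z + s • v) z + dist z c := dist_triangle _ _ _
      _ = ‖s • v‖ + dist z c := by rw [dist_eq_norm, add_sub_cancel_left]
      _ < r + r := add_lt_add h2' h1'
      _ = r2 := by rw [hr]; ring
  -- the key identities
  have hkey : Λ (z + s • v) = φ (θ (Circle.exp s) y) := by
    rw [hequiv z (hΨD hzsrc) s, hΛz, φ.left_inv hyφ]
  have hmemφ : θ (Circle.exp s) y ∈ φ.source := by
    -- `z + s v ∈ D`, whose second clause is `G (z + s v) ∈ φ.source`, and `G (z + s v) = θ (exp s) y`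
    have hD2 := (hΨD hzs).2
    simp only [mem_preimage] at hD2
    have hGeq : G (z + s • v) = θ (Circle.exp s) y := by
      have hτ' : τ (z + s • v) = τ z + s := by
        simp only [hτ]
        rw [add_sub_right_comm, map_add, map_smul, hℓv, smul_eq_mul, mul_one]
      have ha' : a (z + s • v) = a z := by
        simp only [ha]
        rw [add_sub_right_comm, map_add, map_smul, hPv, smul_zero, add_zero]
      have hGz : G z = y := by
        have h := φ.left_inv (hΨD hzsrc).2
        -- `φ.symm (φ (G z)) = G z` and `φ (G z) = Λ z = φ y`
        change φ.symm (Λ z) = G z at h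
        rw [hΛz, φ.left_inv hyφ] at h
        exact h.symm
      simp only [hG, hτ', ha']
      rw [add_comm, Circle.exp_add, hmul]
      exact congrArg _ hGz
    rwa [hGeq] at hD2
  refine ⟨?_, ?_⟩
  · rw [hψsrc]
    refine ⟨hmemφ, ?_⟩
    rw [mem_preimage, ← hkey, ← hΨΛ]
    exact Ψ.map_source hzs
  · rw [hψ_apply, ← hkey, ← hΨΛ, Ψ.left_inv hzs]


/-! ### No returns away from the identity -/

section Returns

variable {X : Type*} [TopologicalSpace X] [T2Space X] {θ : Circle → X → X}

/-- **A free circle action returns near a point only near the identity**: for a continuous free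
circle action on a Hausdorff space and a neighbourhood `U₁` of `1 ∈ S¹`, every point `n` has a
neighbourhood `W` such that `y ∈ W`, `θ a y ∈ W` force `a ∈ U₁`. (The pairs `(y, θ a y)` with
`a ∉ U₁` form a closed set — a projection along the compact `S¹ ∖ U₁` — not containing `(n, n)` by
freeness; Lee 2012, Thm. 21.10, the Hausdorff / "slice meets each orbit once" step for compact
`G`.) [cite: LeeSmoothManifolds2013, Thm. 21.10] -/
theorem exists_nhds_forall_circleAct_mem_imp (hcont : Continuous fun p : Circle × X => θ p.1 p.2)
    (hfree : ∀ a x, θ a x = x → a = 1) (n : X) {U₁ : Set Circle} (hU₁ : U₁ ∈ 𝓝 (1 : Circle)) :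
    ∃ W ∈ 𝓝 n, ∀ y ∈ W, ∀ a : Circle, θ a y ∈ W → a ∈ U₁ := by
  obtain ⟨U, hUsub, hUo, h1U⟩ := _root_.mem_nhds_iff.1 hU₁
  set Γ : Set (Circle × (X × X)) := {q | q.1 ∈ Uᶜ ∧ q.2.2 = θ q.1 q.2.1} with hΓ
  have hΓc : IsClosed Γ := by
    refine (hUo.isClosed_compl.preimage continuous_fst).inter ?_
    exact isClosed_eq continuous_snd.snd
      (hcont.comp (continuous_fst.prodMk continuous_snd.fst))
  set B : Set (X × X) := Prod.snd '' Γ with hB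
  have hBc : IsClosed B := isClosedMap_snd_of_compactSpace _ hΓc
  have hnB : (n, n) ∉ B := by
    rintro ⟨⟨a, y, y'⟩, ⟨haU, hy'⟩, hq⟩
    simp only [Prod.mk.injEq] at hq hy'
    obtain ⟨rfl, rfl⟩ := hq
    have ha1 : a = 1 := hfree a _ hy'.symm
    rw [ha1] at haU
    exact haU h1U
  have hBn : Bᶜ ∈ 𝓝 (n, n) := hBc.isOpen_compl.mem_nhds hnB
  obtain ⟨W₁, hW₁, W₂, hW₂, hsub⟩ := mem_nhds_prod_iff.1 hBn
  refine ⟨W₁ ∩ W₂, inter_mem hW₁ hW₂, ?_⟩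
  rintro y ⟨hy₁, -⟩ a ⟨-, ha₂⟩
  by_contra haU
  have hmem : (y, θ a y) ∈ B := ⟨⟨a, y, θ a y⟩, ⟨fun h => haU (hUsub h), rfl⟩, rfl⟩
  exact hsub (mk_mem_prod hy₁ ha₂) hmem

/-- The arc `exp (-r, r)` is a neighbourhood of `1 ∈ S¹` (`0 < r ≤ π`). [folklore] -/
theorem centeredArc_mem_nhds_one {r : ℝ} (hr : 0 < r) (hrπ : r ≤ Real.pi) :
    Circle.centeredArc r ∈ 𝓝 (1 : Circle) := by
  have hc : ContinuousAt (fun z : Circle => |Complex.arg z|) 1 := by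
    have h1 : ContinuousAt Complex.arg ((1 : Circle) : ℂ) :=
      Complex.continuousAt_arg (by simp [Complex.slitPlane])
    exact continuous_abs.continuousAt.comp (h1.comp continuous_subtype_val.continuousAt)
  have hmem : {z : Circle | |Complex.arg z| < r} ∈ 𝓝 (1 : Circle) :=
    hc.preimage_mem_nhds (Iio_mem_nhds (by simpa using hr))
  exact Filter.mem_of_superset hmem fun z hz => (Circle.mem_centeredArc hrπ).2 hz

/-- **No returns except near multiples of the period**: for a continuous free circle action on a
Hausdorff space, every point `n` has a neighbourhood `W` such that if `y ∈ W` and `θ a y ∈ W` then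
`a = exp t` with `|t| < ε`. [cite: LeeSmoothManifolds2013, Thm. 21.10] -/
theorem exists_nhds_forall_circleAct_mem_imp_abs_lt
    (hcont : Continuous fun p : Circle × X => θ p.1 p.2)
    (hfree : ∀ a x, θ a x = x → a = 1) (n : X) {ε : ℝ} (hε : 0 < ε) :
    ∃ W ∈ 𝓝 n, ∀ y ∈ W, ∀ a : Circle, θ a y ∈ W → ∃ t : ℝ, |t| < ε ∧ Circle.exp t = a := by
  obtain ⟨W, hW, h⟩ := exists_nhds_forall_circleAct_mem_imp hcont hfree n
    (centeredArc_mem_nhds_one (lt_min hε Real.pi_pos) (min_le_right _ _))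
  refine ⟨W, hW, fun y hy a ha => ?_⟩
  obtain ⟨t, ht, rfl⟩ := h y hy a ha
  exact ⟨t, lt_of_lt_of_le ht (min_le_left _ _), rfl⟩

end Returns

end Literature.Geometry.Manifold

end
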